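import Summits.Ventures.QEC.Census.FoldAssembly
import HarnessLib

/-!
# Fold enumeration — soundness of the node check, the matcher and the base check

Cell `qec`, PARTITION row type-11 ("kernel C"), soundness layer 4 of `Census/FoldDefs.lean`:
* `nodeCheck_sound` — if the node check of a small word `v` passes with continuation `k`, every big
  kernel word of weight `≤ W` folding onto `v` satisfies any mask-predicate implied by `k` (the EMPTY
  branch is justified by `test_complete` on the full column system, the other by `fiber_complete`);
* `matchRep_sound` / `matched_of_matchRep` — a match exhibits a translate among the representatives
  (store invariant `KRupFast.Store.All`, soundness direction only);
* `baseCheck_sound` — the brute-force base over a range of words.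
-/

namespace Summit.Ventures.QEC.Census.Fold

open Summit.Ventures.QEC.Census

namespace Geo

variable {G : Geo}

/-- The full fibre system: the section part of a kernel word folding onto `t = maskOf S` solves
`⊕_{j ∈ a} fcol j = frhs S`. -/
theorem fcol_aPart_eq_frhs (hG : G.OK) {C : TCode} {Mp : ℕ → ℕ} (hMp : ∀ j, j < G.ns → Mp j = pcol G C j)
    {S : List ℕ} (hS : ∀ j ∈ S, j < G.ns) {u : ℕ} (hu : u < 2 ^ G.n) (hker : C.ker G.n u)
    (hfold : G.foldW u = maskOf S) : lin (fcol G C) G.ns 0 (G.aPart u) = frhs Mp S := by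
  set t := maskOf S
  have hab : G.aPart u ^^^ G.bPart u = t := by rw [← foldW_eq_parts, hfold]
  have hbt : G.bPart u = G.aPart u ^^^ t := by rw [← hab, ← Nat.xor_assoc, Nat.xor_self, Nat.zero_xor]
  have h0 : lin C.col G.n 0 u = 0 := hker
  rw [recon hG hu, lin_xor, lin_col_embW hG, lin_col_parW hG, hbt, lin_xor, ← Nat.xor_assoc, ← lin_xor_fun] at h0
  have hrhs : lin (fun j => C.col (G.partner (G.emb j))) G.ns 0 t = frhs Mp S := by
    rw [frhs, xorIdx_congr (h := pcol G C) (fun j hj => hMp j (hS j hj)), xorIdx_eq_lin _ _ _ hS]; rfl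
  rw [hrhs] at h0
  have := xor_eq_of_xor_xor_eq_zero (x := 0) (by rw [Nat.zero_xor]; exact h0)
  rw [Nat.xor_zero] at this
  exact this

/-- What the guarded continuation establishes per output. -/
theorem guardP_cons_sound {p₀ : ℕ} {P' : List ℕ} {k : List ℕ → Bool} {Q : ℕ → Prop}
    (hk : ∀ S', (∀ J ∈ S', J < G.n) → S'.length = popc G.n (maskOf S') → k S' = true → Q (maskOf S')) :
    ∀ S', (∀ J ∈ S', J < G.n) → S'.length = popc G.n (maskOf S') → guardP G (p₀ :: P') k S' = true →
      ((maskOf S').testBit (G.emb p₀) = false ∨ Q (maskOf S')) := by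
  intro S' hS' hlen h
  rw [guardP, Bool.or_eq_true, Bool.not_eq_true'] at h
  rcases h with h | h
  · exact Or.inl h
  · exact Or.inr (hk S' hS' hlen h)

/-- The enumeration branch of the node check: every fibre word satisfies the per-output conclusion. -/
theorem goodFib_of_all (hG : G.OK) {C : TCode} {M Mp : ℕ → ℕ} (hM : ∀ j, j < G.ns → M j = fcol G C j)
    (hMp : ∀ j, j < G.ns → Mp j = pcol G C j) {W : ℕ} {t : ℕ} (ht : t < 2 ^ G.ns) {out : List (List ℕ)}
    (hout : fiber G M Mp W (bitsOf G.ns 0 t) = some out) {kk : List ℕ → Bool} {K : ℕ → Prop}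
    (hkk : ∀ S', (∀ J ∈ S', J < G.n) → S'.length = popc G.n (maskOf S') → kk S' = true → K (maskOf S'))
    (hall : out.all kk = true) : GoodFib G C W K t := by
  intro u hu hker hwt hfold
  obtain ⟨S', hS', hmask, hbnd, hlen⟩ := fiber_complete hG hM hMp ht hout hu hker hwt hfold
  rw [List.all_eq_true] at hall
  have := hkk S' hbnd (by rw [hmask]; exact hlen) (hall S' hS')
  rwa [hmask] at this

end Geo

/-- **NODE CHECK SOUNDNESS**: a passing node check of the small word with support `S` gives the fibre
property `GoodFib … Q (maskOf S)` — the EMPTY branch by the certified reduction, the enumeration branch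
by `fiber_complete`, the pair guard by `goodFib_of_guarded`. -/
theorem nodeCheck_sound {G : Geo} (hS : G.Shape) (hG : G.OK) {C : TCode} (hC : C.l = G.l ∧ C.m = G.m)
    (heq : C.ColEquiv G.gen.1 G.gen.2) (hcol : ∀ J, J < C.n → C.col J < 2 ^ (C.l * C.m))
    {M Mp Mr : ℕ → ℕ} (hM : ∀ j, j < G.ns → M j = fcol G C j) (hMp : ∀ j, j < G.ns → Mp j = pcol G C j)
    {Pall : Piv} (hPall : pivOK ((List.range G.ns).map M) Pall = true) (hMr : ∀ j, j < G.ns → Mr j = Pall.red (Mp j))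
    {W : ℕ} {k : List ℕ → Bool} {Q : ℕ → Prop} (hQ : ∀ u, Q (transW G.l G.m G.gen.1 G.gen.2 u) → Q u)
    (hk : ∀ S', (∀ J ∈ S', J < G.n) → S'.length = popc G.n (maskOf S') → k S' = true → Q (maskOf S'))
    {S : List ℕ} (hSb : ∀ j ∈ S, j < G.ns) (h : nodeCheck G M Mp Mr W k S = true) :
    GoodFib G C W Q (maskOf S) := by
  have hSlt : maskOf S < 2 ^ G.ns := maskOf_lt _ _ hSb
  rw [nodeCheck, Bool.or_eq_true] at h
  rcases h with h | h
  · -- certified-empty branch: impossible, a fibre word would give a solution of the full system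
    intro u hu hker hwt hfold
    exfalso
    simp only [Bool.not_eq_true', beq_eq_false_iff_ne, ne_eq] at h
    have hsol := Geo.fcol_aPart_eq_frhs hG hMp hSb hu hker hfold
    have heqs : selXor ((List.range G.ns).map M) (G.aPart u) = lin (fcol G C) G.ns 0 (G.aPart u) := by
      rw [selXor, List.length_map, List.length_range]
      exact lin_congr (i0 := 0) (fun j hj => by
        rw [Nat.zero_add, List.getD_eq_getElem?_getD, List.getElem?_map, List.getElem?_range hj, Option.map_some,
          Option.getD_some, hM j hj]) _
    have hred := red_selXor hPall (G.aPart u)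
    rw [heqs, hsol, frhs, red_xorIdx] at hred
    rw [xorIdx_congr (h := fun j => Pall.red (Mp j)) (fun j hj => hMr j (hSb j hj))] at h
    exact h hred
  · simp only at h
    split at h
    · simp at h
    · rename_i out hout
      have hout' : fiber G M Mp W (bitsOf G.ns 0 (maskOf S)) = some out := hout
      cases hP : bitsOf G.ns 0 (maskOf S) with
      | nil =>
        rw [hP] at h
        exact Geo.goodFib_of_all hG hM hMp hSlt hout' (kk := guardP G [] k) (K := Q)
          (fun S' hS' hl h' => hk S' hS' hl (by simpa [guardP] using h')) h
      | cons p₀ P' =>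
        rw [hP] at h
        have hK := Geo.goodFib_of_all hG hM hMp hSlt hout' (kk := guardP G (p₀ :: P') k)
          (K := fun u => u.testBit (G.emb p₀) = false ∨ Q u) (Geo.guardP_cons_sound (p₀ := p₀) (P' := P') hk) h
        have hp₀ : p₀ ∈ bitsOf G.ns 0 (maskOf S) := by rw [hP]; exact List.mem_cons_self ..
        rw [mem_bitsOf_zero_iff] at hp₀
        exact Geo.goodFib_of_guarded hG hS hC heq hcol hSlt hp₀.1 hp₀.2 hQ hK

namespace Geo
end Geo

/-! ## The matcher -/

/-- `repStore_all`: repStore all (auxiliary lemma of the fold-certificate soundness chain). -/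
theorem repStore_all (md : ℕ) (reps : List ℕ) : (repStore md reps).All (· ∈ reps) := by
  rw [repStore]
  suffices h : ∀ (L : List ℕ) (S : KRupFast.Store), S.All (· ∈ reps) → (∀ w ∈ L, w ∈ reps) →
      (L.foldl (fun S w => KRupFast.Store.ins 40 S (hkey md w) w) S).All (· ∈ reps) from
    h reps .nil (KRupFast.Store.All_nil _) (fun w hw => hw)
  intro L
  induction L with
  | nil => intro S hS _; exact hS
  | cons w L ih =>
    intro S hS hL
    exact ih _ (KRupFast.Store.All.ins (hL w (by simp)) _ _ hS _) fun w' hw' => hL w' (by simp [hw'])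

/-- A successful match: either the zero word with `zeroOK`, or an anchored translate that is stored. -/
theorem matchRep_sound {l m md : ℕ} {store : KRupFast.Store} {reps : List ℕ} (hstore : store.All (· ∈ reps))
    {zeroOK : Bool} {S : List ℕ} {d : ℕ × ℕ} (h : matchRep l m md store zeroOK S = some d) :
    (S = [] ∧ zeroOK = true) ∨ transMask l m d.1 d.2 S ∈ reps := by
  unfold matchRep at h
  split at h
  · left
    refine ⟨rfl, ?_⟩
    split at h
    · assumption
    · simp at h
  · right
    rename_i S' hne
    have hd := List.find?_some h
    simp only [Bool.and_eq_true, Bool.not_eq_true', beq_eq_false_iff_ne, ne_eq, beq_iff_eq] at hd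
    rcases KRupFast.Store.All.get hstore (hkey md (transMask l m d.1 d.2 S)) with h0 | hP
    · exact absurd h0 hd.1
    · rw [hd.2] at hP; exact hP

/-- `transMask` of a support list inside the window is the translation of its word. -/
theorem transMask_eq_transW {l m da db : ℕ} {S : List ℕ} (hS : ∀ j ∈ S, j < 2 * (l * m)) :
    transMask l m da db S = transW l m da db (maskOf S) := by
  rw [transMask, transW, xorIdx_eq_lin _ _ _ hS]

/-- A match certifies `Matched` (with `zeroOK := reps.elem 0`). -/
theorem matched_of_matchRep {l m md : ℕ} {reps : List ℕ} {S : List ℕ} (hS : ∀ j ∈ S, j < 2 * (l * m))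
    (h : (matchRep l m md (repStore md reps) (reps.elem 0) S).isSome = true) : Matched l m reps (maskOf S) := by
  rw [Option.isSome_iff_exists] at h
  obtain ⟨d, hd⟩ := h
  rcases matchRep_sound (repStore_all md reps) hd with ⟨rfl, h0⟩ | hmem
  · refine ⟨0, by simpa using h0, 0, 0, ?_⟩
    simp [transW]
  · exact ⟨_, hmem, d.1, d.2, by rw [← transMask_eq_transW hS]⟩

/-! ## The base check -/

/-- `baseCheck_sound`: baseCheck sound (auxiliary lemma of the fold-certificate soundness chain). -/
theorem baseCheck_sound (C : TCode) (n W md : ℕ) (store : KRupFast.Store) (zeroOK : Bool) (lo : ℕ) :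
    ∀ cnt, baseCheck C n W md store zeroOK lo cnt = true →
      ∀ u, lo ≤ u → u < lo + cnt → lin C.col n 0 u = 0 → popc n u ≤ W →
        (matchRep C.l C.m md store zeroOK (bitsOf n 0 u)).isSome = true := by
  intro cnt
  induction cnt with
  | zero => intro _ u h1 h2; omega
  | succ i ih =>
    intro h u hlo hhi hker hwt
    have h' : baseCheck C n W md store zeroOK lo i = true ∧
        (!(lin C.col n 0 (lo + i) == 0) || !(popc n (lo + i) ≤ W) ||
          (matchRep C.l C.m md store zeroOK (bitsOf n 0 (lo + i))).isSome) = true := by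
      rw [← Bool.and_eq_true]; exact h
    by_cases hu : u < lo + i
    · exact ih h'.1 u hlo hu hker hwt
    · have hui : u = lo + i := by omega
      subst hui
      have h2 := h'.2
      simp only [Bool.or_eq_true, Bool.not_eq_true', beq_eq_false_iff_ne, ne_eq, decide_eq_false_iff_not] at h2
      rcases h2 with (h2 | h2) | h2
      · exact absurd hker h2
      · exact absurd hwt h2
      · exact h2

/-- Base completeness on a range inside the window, as `Matched`. -/
theorem matched_of_baseCheck (C : TCode) {W md lo cnt : ℕ} {reps : List ℕ} (hrange : lo + cnt ≤ 2 ^ C.n)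
    (h : baseCheck C C.n W md (repStore md reps) (reps.elem 0) lo cnt = true) :
    ∀ u, lo ≤ u → u < lo + cnt → C.ker C.n u → popc C.n u ≤ W → Matched C.l C.m reps u := by
  intro u hlo hhi hker hwt
  have hun : u < 2 ^ C.n := lt_of_lt_of_le hhi hrange
  have := matched_of_matchRep (fun j hj => by
    have := lt_of_mem_bitsOf hj; rw [TCode.n] at this; exact this)
    (baseCheck_sound C C.n W md _ _ lo cnt h u hlo hhi hker hwt)
  rwa [maskOf_bitsOf_zero _ _ hun] at this

end Summit.Ventures.QEC.Census.Fold

namespace Summit.Ventures.QEC.Census.Fold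

open Summit.Ventures.QEC.Census

/-- Slices cover `List.all`: if every residue class passes, every element passes. -/
theorem all_of_allMod {q : ℕ} (hq : 0 < q) {k : List ℕ → Bool} :
    ∀ (L : List (List ℕ)) (i : ℕ), (∀ res, res < q → allMod q res k L i = true) → L.all k = true := by
  intro L
  induction L with
  | nil => intro i _; rfl
  | cons S L ih =>
    intro i h
    rw [List.all_cons, Bool.and_eq_true]
    constructor
    · have := h (i % q) (Nat.mod_lt _ hq)
      rw [allMod, Bool.and_eq_true] at this
      simpa using this.1
    · exact ih (i + 1) fun res hres => by
        have := h res hres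
        rw [allMod, Bool.and_eq_true] at this
        exact this.2

/-- All slices of a node check make the node check. -/
theorem nodeCheck_of_nodeCheckMod {G : Geo} {M Mp Mr : ℕ → ℕ} {W : ℕ} {k : List ℕ → Bool} {S : List ℕ} {q : ℕ}
    (hq : 0 < q) (h : ∀ res, res < q → nodeCheckMod G M Mp Mr W k S q res = true) :
    nodeCheck G M Mp Mr W k S = true := by
  by_cases hf : (xorIdx Mr S == 0) = true
  · unfold nodeCheck
    simp only [hf, Bool.not_true, Bool.false_or]
    split
    · rename_i hnone
      have := h 0 hq
      unfold nodeCheckMod at this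
      simp [hf, hnone] at this
    · rename_i out hout
      refine all_of_allMod hq out 0 fun res hres => ?_
      have := h res hres
      unfold nodeCheckMod at this
      simp only [hf, Bool.not_true, Bool.false_or, hout] at this
      exact this
  · unfold nodeCheck
    simp only [Bool.not_eq_true] at hf
    simp [hf]

end Summit.Ventures.QEC.Census.Fold

namespace Summit.Ventures.QEC.Census.Fold

open Summit.Ventures.QEC.Census

/-! ## The split-table base check -/

/-- Splitting a `lin` at bit `k`. -/
theorem lin_split (g : ℕ → ℕ) (k b : ℕ) : ∀ (i0 u : ℕ),
    lin g (k + b) i0 u = lin g k i0 (u % 2 ^ k) ^^^ lin g b (i0 + k) (u / 2 ^ k) := by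
  induction k with
  | zero => intro i0 u; simp [lin]
  | succ k ih =>
    intro i0 u
    rw [Nat.succ_add, lin_succ, lin_succ, ih]
    have h1 : u % 2 ^ (k + 1) % 2 = u % 2 := by rw [Nat.pow_succ', Nat.mod_mul]; omega
    have h2 : u % 2 ^ (k + 1) / 2 = u / 2 % 2 ^ k := by rw [Nat.pow_succ', Nat.mod_mul_right_div_self]
    have h3 : u / 2 ^ (k + 1) = u / 2 / 2 ^ k := by rw [Nat.pow_succ', Nat.div_div_eq_div_mul]
    rw [h1, h2, h3, show i0 + (k + 1) = i0 + 1 + k from by omega, Nat.xor_assoc]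

/-- Splitting `popc` at bit `k`. -/
theorem popc_split (k b : ℕ) : ∀ u, popc (k + b) u = popc k (u % 2 ^ k) + popc b (u / 2 ^ k) := by
  induction k with
  | zero => intro u; simp [popc]
  | succ k ih =>
    intro u
    rw [Nat.succ_add, popc_succ, popc_succ, ih]
    have h1 : u % 2 ^ (k + 1) % 2 = u % 2 := by rw [Nat.pow_succ', Nat.mod_mul]; omega
    have h2 : u % 2 ^ (k + 1) / 2 = u / 2 % 2 ^ k := by rw [Nat.pow_succ', Nat.mod_mul_right_div_self]
    have h3 : u / 2 ^ (k + 1) = u / 2 / 2 ^ k := by rw [Nat.pow_succ', Nat.div_div_eq_div_mul]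
    rw [h1, h2, h3]; omega

/-- Each step of `minTrans` is a translation; so the result is a translate (given the tables). -/
theorem minTrans_spec {l m w k : ℕ} (trs : List (ℕ × ℕ)) (ds : List (ℕ × ℕ))
    (htr : ∀ i, i < trs.length → ∀ u, u < 2 ^ (2 * (l * m)) →
      tab (trs.getD i (0,0)).1 w (u % 2 ^ k) ^^^ tab (trs.getD i (0,0)).2 w (u / 2 ^ k) =
        transW l m (ds.getD i (0,0)).1 (ds.getD i (0,0)).2 u)
    (hlen : ds.length = trs.length) (u : ℕ) (hu : u < 2 ^ (2 * (l * m))) :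
    ∃ da db, minTrans trs w k u = transW l m da db u ∨ (minTrans trs w k u = u) := by
  induction trs generalizing ds with
  | nil => exact ⟨0, 0, Or.inr rfl⟩
  | cons tp trs ih =>
    cases ds with
    | nil => simp at hlen
    | cons d ds =>
      have ih' := ih ds (fun i hi v hv => htr (i + 1) (by simp; omega) v hv) (by simpa using hlen)
      simp only [minTrans] at ih' ⊢
      -- the fold: acc := result over trs … then compared with this tp's translate
      set acc := List.rec (motive := fun _ => ℕ) u
        (fun tp _ acc => let v := tab tp.1 w (u % 2 ^ k) ^^^ tab tp.2 w (u / 2 ^ k); cond (Nat.ble acc v) acc v) trs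
      have h0 := htr 0 (by simp) u hu
      simp only [List.getD_cons_zero] at h0
      show ∃ da db, (cond (Nat.ble acc _) acc _) = transW l m da db u ∨ (cond (Nat.ble acc _) acc _) = u
      cases Nat.ble acc (tab tp.1 w (u % 2 ^ k) ^^^ tab tp.2 w (u / 2 ^ k))
      · exact ⟨d.1, d.2, Or.inl (by simp [h0])⟩
      · simpa using ih'

/-- **BASE CHECK SOUNDNESS (split tables).** -/
theorem matched_of_baseCheck2 {C : TCode} {k w W md : ℕ} (hn : C.n = k + k) (hl : 0 < C.l) (hm : 0 < C.m)
    {SL SR PL PR : ℕ} (hSL : ∀ x, x < 2 ^ k → tab SL w x = lin C.col k 0 x)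
    (hSR : ∀ x, x < 2 ^ k → tab SR w x = lin C.col k k x)
    (hPL : ∀ x, x < 2 ^ k → tab PL 8 x = popc k x) (hPR : ∀ x, x < 2 ^ k → tab PR 8 x = popc k x)
    {trs : List (ℕ × ℕ)} {ds : List (ℕ × ℕ)}
    (htr : ∀ i, i < trs.length → ∀ u, u < 2 ^ (2 * (C.l * C.m)) →
      tab (trs.getD i (0,0)).1 w (u % 2 ^ k) ^^^ tab (trs.getD i (0,0)).2 w (u / 2 ^ k) =
        transW C.l C.m (ds.getD i (0,0)).1 (ds.getD i (0,0)).2 u)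
    (hlen : ds.length = trs.length) {reps : List ℕ} (h0 : 0 ∈ reps) {lo cnt : ℕ} (hrange : lo + cnt ≤ 2 ^ C.n)
    (h : baseCheck2 SL SR PL PR w k W md trs (repStore md reps) lo cnt = true) :
    ∀ u, lo ≤ u → u < lo + cnt → C.ker C.n u → popc C.n u ≤ W → Matched C.l C.m reps u := by
  have hN : C.n = 2 * (C.l * C.m) := rfl
  intro u hlo hhi hker hwt
  -- peel the loop down to index i = u - lo
  have key : ∀ cnt, baseCheck2 SL SR PL PR w k W md trs (repStore md reps) lo cnt = true → u < lo + cnt →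
      (let ul := u % 2 ^ k; let uh := u / 2 ^ k;
       !(tab SL w ul ^^^ tab SR w uh == 0) || !(tab PL 8 ul + tab PR 8 uh ≤ W) ||
         (let c := minTrans trs w k u; (c == 0) || (repStore md reps).get (hkey md c) == c)) = true := by
    intro cnt
    induction cnt with
    | zero => intro _ h2; omega
    | succ i ih =>
      intro hc hui
      unfold baseCheck2 at hc
      rw [Bool.and_eq_true] at hc
      by_cases hu' : u < lo + i
      · exact ih hc.1 hu'
      · have : u = lo + i := by omega
        subst this
        exact hc.2
  have hk := key cnt h hhi
  have hulk : u % 2 ^ k < 2 ^ k := Nat.mod_lt _ (Nat.two_pow_pos k)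
  have hun : u < 2 ^ C.n := lt_of_lt_of_le hhi hrange
  have huhk : u / 2 ^ k < 2 ^ k := by
    rw [Nat.div_lt_iff_lt_mul (Nat.two_pow_pos k), ← Nat.pow_add, ← hn]; exact hun
  simp only [Bool.or_eq_true, Bool.not_eq_true', beq_eq_false_iff_ne, ne_eq, decide_eq_false_iff_not, beq_iff_eq] at hk
  -- syndrome and weight via tables
  have hsyn : tab SL w (u % 2 ^ k) ^^^ tab SR w (u / 2 ^ k) = 0 := by
    rw [hSL _ hulk, hSR _ huhk]
    have := lin_split C.col k k 0 u
    rw [Nat.zero_add, ← hn] at this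
    rw [← this]; exact hker
  have hw : tab PL 8 (u % 2 ^ k) + tab PR 8 (u / 2 ^ k) ≤ W := by
    rw [hPL _ hulk, hPR _ huhk, ← popc_split, ← hn]; exact hwt
  rcases hk with (hk | hk) | hk
  · exact absurd hsyn hk
  · exact absurd hw hk
  · obtain ⟨da, db, hmt⟩ := minTrans_spec trs ds htr hlen u (hN ▸ hun)
    rcases hk with hk | hk
    · -- minimal translate is 0: so u = 0 (translation injective) or u itself 0
      rcases hmt with hmt | hmt
      · rw [hmt] at hk
        have : u = 0 := by
          have := transW_inv hl hm (hN ▸ hun) da db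
          rw [hk, transW, lin_zero] at this; exact this.symm
        subst this
        exact ⟨0, h0, 0, 0, by rw [transW, lin_zero]⟩
      · rw [hmt] at hk; subst hk
        exact ⟨0, h0, 0, 0, by rw [transW, lin_zero]⟩
    · have hget := KRupFast.Store.All.get (repStore_all md reps) (hkey md (minTrans trs w k u))
      rw [hk] at hget
      rcases hget with hz | hmem
      · -- fetched value 0 means c = 0, handled as above
        rcases hmt with hmt | hmt
        · have : u = 0 := by
            have := transW_inv hl hm (hN ▸ hun) da db
            rw [← hmt, hz, transW, lin_zero] at this; exact this.symm
          subst this; exact ⟨0, h0, 0, 0, by rw [transW, lin_zero]⟩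
        · rw [hmt] at hz; subst hz; exact ⟨0, h0, 0, 0, by rw [transW, lin_zero]⟩
      · rcases hmt with hmt | hmt
        · exact ⟨_, hmem, da, db, hmt.symm⟩
        · exact ⟨_, hmem, 0, 0, by rw [transW_zero hl hm (hN ▸ hun), hmt]⟩

end Summit.Ventures.QEC.Census.Fold
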